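import Summits.QuantumFields.YangMills.Theorems.UnitScaleTiltHalvingStepOfPillarsCEPair
import Summits.QuantumFields.YangMills.Theorems.UnitScaleTiltHalvingCompetitorMapAction
import Summits.QuantumFields.YangMills.Theorems.UnitScaleTiltProp8ChartKernelFlatTower
import Summits.QuantumFields.YangMills.Theorems.UnitScaleTiltHalvingCompetitorRegularOpen
import HarnessLib

/-!
# Route `UnitScaleTilt`, crux K1 «MinimiserStabilityRegPr» (stmt-QuantumFields-19200), stub V2′ `stub_halvingStep` — (K-E2E) door, C_E end, lemma L2″ = THE REPAIRED L2′:
# **HYPOTHESIS (i) OF THE (165)-A₁ ROW FROM THE ROUTE'S MINIMALITY THROUGH THE LOCALISED COMPETITOR MAP, WITH AN INHABITABLE FIBRE BINDER** (LEAD ★w5-19200 g4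
# RULING L-1 (R1)∕(R2)∕(R3); ✓`hpair_of_hcrit_local` (L2′, ★w8-19200 s2) VERBATIM except for the (Φ-1′) binder and the regularity cut)

Cell `ym3-torus` (HUMAN RULING D-0037: rung R3, not Clay), width seat `ym-ust-19200-w1` g7 (the L2′ text and proof are ★w8-19200 s2's; this file changes three binders).
`--supports stmt-QuantumFields-19200 --as helper`; def-free, 0 sorry.

WHY.  L2′ displays (Φ-1′) as `hΦ1 : ∀ X ∈ T, uS⁻¹ • Φloc X ∈ regFibrePr … V` with the FIXED gauge `uS⁻¹`.  That binder has no inhabitant for a generic competitor: `fibre … V`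
is EXACT descent `D_{n,K}U = V`, and `D_{n,K}(Φloc X) = (q_X·(uS)_k) • V` with `q_X` the accumulated-frame quotient (✓`HalvingCompetitorMapFrames`), which reads the deep
(non-index) double-bar variables — free directions of `T`; nor is every `X` of the `r₁`-ball `ε₀`-regular.  The dischargeable shape (✓`HalvingCompetitorMapFibreLocal.
exists_gaugeAct_mem_fibre_of_chart49`, ★w1 g7) is the `∃`-GAUGE FIBRE HALF ON REGULAR COMPETITORS:
  `hΦ1 : ∀ X ∈ T, RegPr ε₀ (Φloc X) → ∃ h : SU(2)^{sites}, h • Φloc X ∈ fibre … V`.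
WHAT CHANGES (everything else — `hexp`, `hoff` = pinning + level-0 dressing, `hΨsa`, `hD`, `hAQ` — is L2′'s proof byte for byte):
* the competitor set of the S11 run is CUT DOWN to the regular competitors, `S₀ := r₁-ball ∩ {X | RegPr ε₀ (Φloc X)}` (LEAD L-1 (R2) «regularity by openness»): it is open
  along every line through `A` by ✓`HalvingCompetitorRegularOpen.lineOpen_inter_regPr` (★w1 g7, p623023) — `Φloc A = uS • Umin` is regular (`hUmin`, gauge invariance) and
  the competitor lines `t ↦ Φloc (A + tδ)` are continuous at `0` (NEW displayed `hUcont`: the chart `Uc` is continuous — §1 `exists_su2Chart_continuous` supplies such a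
  chart with L2′'s `hUc` clause, so L3′ only swaps its witness; `D` is continuous at `A` by `hDd`; `H` is linear on a finite-dimensional space);
* `hmin` on that set: for a regular competitor pick the gauge copy `h • Φloc X ∈ fibre V`; it is in `regFibrePr V` (✓`regPr_gaugeAct_iff`), so `𝒲(Umin) ≤ 𝒲(h • Φloc X) =
  𝒲(Φloc X)` and `𝒲(Φloc A) = 𝒲(uS • Umin) = 𝒲(Umin)` (✓`wilsonAction_gaugeAct`).
DISPLAYED: (Φ-2′) `hchartNear` as in L2′; (Φ-1′) `hΦ1` in the `∃`-gauge form above; `hUmin : Umin ∈ regFibrePr … V`, `0 ≤ ε₀`, `hUcont`.  CONCLUSION = L2′'s `hpair` VERBATIM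
(so L3′ := ✓`ceRows_at_member` with these binders and its one call to L2′ replaced).
HONEST SCOPE: finite sums, first-order calculus and bookkeeping; NOT a claim about the stub, the crux, the rung or the gap.

References: T. Bałaban, CMP **102** (1985) 277–309 [Balaban1985Variational] (5)–(6) p.278, (44)–(49) p.285, (99) p.293, (150) p.301, (152) p.301, (157)–(158) p.302;
CMP **99** (1985) 75–102 [Balaban1985RegularSpaces] p.77; CMP **96** (1984) 223–250 [Balaban1984PropagatorsII] (2.3)–(2.4) p.224 (`Λ₀ = Ω₁ᶜ` frozen).
-/

set_option autoImplicit false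

noncomputable section

open scoped BigOperators Matrix Matrix.Norms.L2Operator
open NormedSpace

namespace Summit.QuantumFields.YangMills.Theorems.HalvingSitePackage

open Literature.MathematicalPhysics.QuantumFieldTheory.Balaban1983to89
open Literature.MathematicalPhysics.QuantumFieldTheory.Balaban1983to89.T3ContinuumYM3Torus
open Literature.MathematicalPhysics.QuantumFieldTheory.Balaban1983to89.T3PrintedRegularMinimiser
open B6SectADomainsV1 (Domains)
open B6SectAOperatorsV1 (BondIdx QE)
open LatticeFieldCalculus (bondAvgIter)
open B5Eq120IterProof (bondAvgIter_zero)
open FlatCubeOpsText (IsLevWeight)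
open FlatOpsLettersAssembly (flatH levWeight_nonneg)
open Prop8ChartDoubleBar (chartLogFlat chartLogFlat_apply fderiv_chartLogFlat_zero_apply dressed_competitor_su2 exists_lineRadius_of_mem_weightedBall)
open Literature.MathematicalPhysics.QuantumFieldTheory.Balaban1983to89.T3UnitLawDensityEML (ℰp)
open Literature.MathematicalPhysics.QuantumFieldTheory.Balaban1983to89.T3ConstrainedMinimiser (fibre)
open Literature.MathematicalPhysics.QuantumFieldTheory.Balaban1983to89.T3PrintedRegularOrbits (regPr_gaugeAct_iff)
open HalvingCompetitorRegularOpen (lineOpen_inter_regPr regPr_gaugeAct_of_mem_regFibrePr)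

variable {F : T3Family} {n K : ℕ}

/-! ## §1 A continuous `SU(2)` chart -/

/-- **A CONTINUOUS `SU(2)` CHART OF 𝔰𝔲(2)-VALUED FIELDS**: `Y ↦ (b ↦ exp(iη·π(Y b)))` with `π` the traceless-self-adjoint projection `M ↦ S − (tr S∕2)·1`, `S = (M + Mᴴ)∕2`:
it is `e^{iηY(b)}` on self-adjoint traceless `Y` (the clause of ✓`exists_su2Chart`) AND every bond value depends continuously on `Y`. [cite: Balaban1985Variational, (5) p.278, (152) p.301] -/
theorem exists_su2Chart_continuous {P : Params} (η : ℝ) :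
    ∃ U : (PBond P 0 → Matrix (Fin 2) (Fin 2) ℂ) → GaugeField P 0 (Matrix.specialUnitaryGroup (Fin 2) ℂ),
      (∀ Y : PBond P 0 → Matrix (Fin 2) (Fin 2) ℂ, (∀ b, IsSelfAdjoint (Y b)) → (∀ b, Matrix.trace (Y b) = 0) →
        ∀ b, ((U Y b : Matrix.specialUnitaryGroup (Fin 2) ℂ) : Matrix (Fin 2) (Fin 2) ℂ) = exp ((Complex.I * (η : ℂ)) • Y b)) ∧
      ∀ b, Continuous fun Y : PBond P 0 → Matrix (Fin 2) (Fin 2) ℂ => ((U Y b : Matrix.specialUnitaryGroup (Fin 2) ℂ) : Matrix (Fin 2) (Fin 2) ℂ) := by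
  -- the projection
  let π : Matrix (Fin 2) (Fin 2) ℂ → Matrix (Fin 2) (Fin 2) ℂ := fun M =>
    (2 : ℂ)⁻¹ • (M + star M) - ((2 : ℂ)⁻¹ * Matrix.trace ((2 : ℂ)⁻¹ • (M + star M))) • (1 : Matrix (Fin 2) (Fin 2) ℂ)
  have hS : ∀ M : Matrix (Fin 2) (Fin 2) ℂ, IsSelfAdjoint ((2 : ℂ)⁻¹ • (M + star M)) := fun M => by
    rw [IsSelfAdjoint, star_smul, star_add, star_star, add_comm (star M) M]
    norm_num
  have htrS : ∀ M : Matrix (Fin 2) (Fin 2) ℂ, star (Matrix.trace ((2 : ℂ)⁻¹ • (M + star M))) = Matrix.trace ((2 : ℂ)⁻¹ • (M + star M)) := fun M => by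
    rw [← Matrix.trace_conjTranspose]
    exact congrArg Matrix.trace (hS M)
  have hπsa : ∀ M, IsSelfAdjoint (π M) := fun M => by
    refine (hS M).sub ?_
    rw [IsSelfAdjoint, star_smul, star_one, star_mul', htrS M]
    norm_num
  have hπtr : ∀ M, Matrix.trace (π M) = 0 := fun M => by
    simp only [π, Matrix.trace_sub, Matrix.trace_smul, Matrix.trace_one, Fintype.card_fin, smul_eq_mul]
    push_cast
    ring
  have hπid : ∀ M : Matrix (Fin 2) (Fin 2) ℂ, IsSelfAdjoint M → Matrix.trace M = 0 → π M = M := fun M hM htr => by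
    have h2 : (2 : ℂ)⁻¹ • (M + star M) = M := by
      rw [hM.star_eq, ← two_smul ℂ M, smul_smul]; norm_num
    simp only [π, h2, htr, mul_zero, zero_smul, sub_zero]
  have hSc : Continuous fun M : Matrix (Fin 2) (Fin 2) ℂ => (2 : ℂ)⁻¹ • (M + star M) :=
    (continuous_const_smul ((2 : ℂ)⁻¹)).comp ((continuous_id (X := Matrix (Fin 2) (Fin 2) ℂ)).add continuous_star)
  have htc : Continuous fun M : Matrix (Fin 2) (Fin 2) ℂ => (2 : ℂ)⁻¹ * Matrix.trace ((2 : ℂ)⁻¹ • (M + star M)) :=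
    (continuous_const_smul ((2 : ℂ)⁻¹)).comp hSc.matrix_trace
  have hπc : Continuous π :=
    hSc.sub (htc.smul (continuous_const (y := (1 : Matrix (Fin 2) (Fin 2) ℂ))))
  -- membership in `SU(2)`
  have hmem : ∀ M : Matrix (Fin 2) (Fin 2) ℂ, exp ((Complex.I * (η : ℂ)) • π M) ∈ Matrix.specialUnitaryGroup (Fin 2) ℂ := by
    intro M
    have hskew : star (Complex.I • π M) = -(Complex.I • π M) := by
      rw [star_smul, Complex.star_def, Complex.conj_I, (hπsa M).star_eq, neg_smul]
    have htr' : (Complex.I • π M).trace = 0 := by rw [Matrix.trace_smul, hπtr, smul_zero]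
    have h := ExpMeanLog.exp_smul_mem_specialUnitaryGroup hskew htr' η
    rwa [smul_smul, mul_comm (η : ℂ)] at h
  refine ⟨fun Y b => ⟨exp ((Complex.I * (η : ℂ)) • π (Y b)), hmem (Y b)⟩, fun Y hsa htr b => ?_, fun b => ?_⟩
  · show exp ((Complex.I * (η : ℂ)) • π (Y b)) = _
    rw [hπid (Y b) (hsa b) (htr b)]
  · show Continuous fun Y : PBond P 0 → Matrix (Fin 2) (Fin 2) ℂ => exp ((Complex.I * (η : ℂ)) • π (Y b))
    letI : NormedAlgebra ℚ (Matrix (Fin 2) (Fin 2) ℂ) := NormedAlgebra.restrictScalars ℚ ℂ _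
    have h1 : Continuous fun Y : PBond P 0 → Matrix (Fin 2) (Fin 2) ℂ => π (Y b) := hπc.comp (continuous_apply b)
    exact NormedSpace.exp_continuous.comp ((continuous_const_smul (Complex.I * (η : ℂ))).comp h1)

/-! ## §2 L2″ -/

-- heartbeat budget (HOME README rule): > 60-line signature with two FILE-E-sized formula hypotheses; budgeted 400k on this declaration only
set_option maxHeartbeats 400000 in
/-- **L2″: (i) OF THE (165) ROW FROM `hcrit` THROUGH THE LOCALISED COMPETITOR MAP, `∃`-GAUGE FIBRE BINDER** — see the module docstring; `A` is the chart preimage (L1's `A′`), `H` the level-scaled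
extension `Hs`, `D` the dressing map `Dsel` of FILE E, `Uc` an `SU(2)` chart of 𝔰𝔲(2)-valued fields (✓`exists_su2Chart`), `Near`∕`Tch` the charted bonds ∕ the plaquettes touching
the region, `uS` the gauge of the regional chart identity. [cite: Balaban1985Variational, (47)-(49) p.285, (99) p.293, (150) p.301, (157)-(158) p.302; Balaban1984PropagatorsII, (2.3)-(2.4) p.224] -/
theorem hpair_of_hcrit_local_exists (F : T3Family) (n K : ℕ) (Dm : Domains (F.P K)) (hDk : Dm.k = K - n)
    (hcollar : ∀ (i : ℕ) (e : PBond (F.P K) (i + 1)), Dm.LamBond (i + 1) e → ∀ z : Site (F.P K) i, (blockOf z = e.src ∨ blockOf z = e.tgt) → z ∈ Dm.Om i)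
    {w : ℕ → PBond (F.P K) 0 → ℝ} (hw : IsLevWeight F n K Dm w)
    {R : ℝ} (hR : 16 * 3800 * ((((F.P K).d + 2) * (F.P K).L : ℕ) : ℝ) ^ 2 * (F.L : ℝ) * R ≤ 1)
    (η : ℝ) (hη : η ≠ 0)
    (W₀ : (PBond (F.P K) 0 → Matrix (Fin 2) (Fin 2) ℂ) → (PBond (F.P K) 0 → Matrix (Fin 2) (Fin 2) ℂ)) (hSd : Differentiable ℂ (fun A : PBond (F.P K) 0 → Matrix (Fin 2) (Fin 2) ℂ => (∑ p : Plaq (F.P K) 0, (1 - (2 : ℂ)⁻¹ * Matrix.trace (exp ((Complex.I * (η : ℂ)) • A ⟨p.src, p.μ⟩) * exp ((Complex.I * (η : ℂ)) • A ⟨p.src.shift p.μ, p.ν⟩) * exp (-((Complex.I * (η : ℂ)) • A ⟨p.src.shift p.ν, p.μ⟩)) * exp (-((Complex.I * (η : ℂ)) • A ⟨p.src, p.ν⟩)))))))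
    (hgrad : ∀ A δ : PBond (F.P K) 0 → Matrix (Fin 2) (Fin 2) ℂ, fderiv ℂ (fun A : PBond (F.P K) 0 → Matrix (Fin 2) (Fin 2) ℂ => (∑ p : Plaq (F.P K) 0, (1 - (2 : ℂ)⁻¹ * Matrix.trace (exp ((Complex.I * (η : ℂ)) • A ⟨p.src, p.μ⟩) * exp ((Complex.I * (η : ℂ)) • A ⟨p.src.shift p.μ, p.ν⟩) * exp (-((Complex.I * (η : ℂ)) • A ⟨p.src.shift p.ν, p.μ⟩)) * exp (-((Complex.I * (η : ℂ)) • A ⟨p.src, p.ν⟩)))))) A δ =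
      ((η : ℂ) ^ 2 / 2) * ∑ p : Plaq (F.P K) 0, Matrix.trace ((A ⟨p.src, p.μ⟩ + A ⟨p.src.shift p.μ, p.ν⟩ - A ⟨p.src.shift p.ν, p.μ⟩ - A ⟨p.src, p.ν⟩) * (δ ⟨p.src, p.μ⟩ + δ ⟨p.src.shift p.μ, p.ν⟩ - δ ⟨p.src.shift p.ν, p.μ⟩ - δ ⟨p.src, p.ν⟩)) + (η : ℂ) ^ 4 * ∑ b : PBond (F.P K) 0, Matrix.trace (W₀ A b * δ b))
    (H : (BondIdx Dm → Matrix (Fin 2) (Fin 2) ℂ) →ₗ[ℂ] (PBond (F.P K) 0 → Matrix (Fin 2) (Fin 2) ℂ))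
    (hHs : ∀ X b, H X b = ∑ c, (flatH F n K Dm (Pi.single c 1) b * ((F.L : ℝ) ^ (c.1.1 : ℕ) * ((F.L : ℝ)⁻¹) ^ (K - n))⁻¹) • X c)
    (D : (PBond (F.P K) 0 → Matrix (Fin 2) (Fin 2) ℂ) → (BondIdx Dm → Matrix (Fin 2) (Fin 2) ℂ))
    (E : (PBond (F.P K) 0 → Matrix (Fin 2) (Fin 2) ℂ) → (PBond (F.P K) 0 → Matrix (Fin 2) (Fin 2) ℂ))
    (hE : ∀ (Y : PBond (F.P K) 0 → Matrix (Fin 2) (Fin 2) ℂ) (b : PBond (F.P K) 0) (i j : Fin 2), E Y b i j = ((η : ℂ) ^ 4)⁻¹ *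
      (-(((η : ℂ) ^ 2 / 2) * ∑ p : Plaq (F.P K) 0, Matrix.trace ((H (D Y) ⟨p.src, p.μ⟩ + H (D Y) ⟨p.src.shift p.μ, p.ν⟩ - H (D Y) ⟨p.src.shift p.ν, p.μ⟩ - H (D Y) ⟨p.src, p.ν⟩) *
          ((Pi.single b (Matrix.single j i (1 : ℂ)) : PBond (F.P K) 0 → Matrix (Fin 2) (Fin 2) ℂ) ⟨p.src, p.μ⟩ + (Pi.single b (Matrix.single j i (1 : ℂ)) : PBond (F.P K) 0 → Matrix (Fin 2) (Fin 2) ℂ) ⟨p.src.shift p.μ, p.ν⟩ -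
            (Pi.single b (Matrix.single j i (1 : ℂ)) : PBond (F.P K) 0 → Matrix (Fin 2) (Fin 2) ℂ) ⟨p.src.shift p.ν, p.μ⟩ - (Pi.single b (Matrix.single j i (1 : ℂ)) : PBond (F.P K) 0 → Matrix (Fin 2) (Fin 2) ℂ) ⟨p.src, p.ν⟩)))
        - ((η : ℂ) ^ 2 / 2) * ∑ p : Plaq (F.P K) 0, Matrix.trace (((Y - H (D Y)) ⟨p.src, p.μ⟩ + (Y - H (D Y)) ⟨p.src.shift p.μ, p.ν⟩ - (Y - H (D Y)) ⟨p.src.shift p.ν, p.μ⟩ - (Y - H (D Y)) ⟨p.src, p.ν⟩) *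
          (H (fderiv ℂ D Y (Pi.single b (Matrix.single j i (1 : ℂ)))) ⟨p.src, p.μ⟩ + H (fderiv ℂ D Y (Pi.single b (Matrix.single j i (1 : ℂ)))) ⟨p.src.shift p.μ, p.ν⟩ -
            H (fderiv ℂ D Y (Pi.single b (Matrix.single j i (1 : ℂ)))) ⟨p.src.shift p.ν, p.μ⟩ - H (fderiv ℂ D Y (Pi.single b (Matrix.single j i (1 : ℂ)))) ⟨p.src, p.ν⟩))
        - (η : ℂ) ^ 4 * ∑ b' : PBond (F.P K) 0, Matrix.trace (W₀ (Y - H (D Y)) b' * H (fderiv ℂ D Y (Pi.single b (Matrix.single j i (1 : ℂ)))) b')))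
    {r₁ t : ℝ}
    (h49 : ∀ X : PBond (F.P K) 0 → Matrix (Fin 2) (Fin 2) ℂ, (∀ b, w 1 b * ‖X b‖ < r₁) → (fun (Z : PBond (F.P K) 0 → Matrix (Fin 2) (Fin 2) ℂ) => chartLogFlat ((((F.L : ℝ))⁻¹) ^ (K - n)) Dm Z - (fderiv ℂ (chartLogFlat ((((F.L : ℝ))⁻¹) ^ (K - n)) Dm : (PBond (F.P K) 0 → Matrix (Fin 2) (Fin 2) ℂ) → BondIdx Dm → Matrix (Fin 2) (Fin 2) ℂ) 0) Z) (X - H (D X)) = D X)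
    (hsize : ∀ X : PBond (F.P K) 0 → Matrix (Fin 2) (Fin 2) ℂ, (∀ b, w 1 b * ‖X b‖ < r₁) → ∀ c, ‖D X c‖ ≤ t)
    (huniq : ∀ X : PBond (F.P K) 0 → Matrix (Fin 2) (Fin 2) ℂ, (∀ b, w 1 b * ‖X b‖ < r₁) → ∀ D' : BondIdx Dm → Matrix (Fin 2) (Fin 2) ℂ, (∀ c, ‖D' c‖ ≤ t) → (fun (Z : PBond (F.P K) 0 → Matrix (Fin 2) (Fin 2) ℂ) => chartLogFlat ((((F.L : ℝ))⁻¹) ^ (K - n)) Dm Z - (fderiv ℂ (chartLogFlat ((((F.L : ℝ))⁻¹) ^ (K - n)) Dm : (PBond (F.P K) 0 → Matrix (Fin 2) (Fin 2) ℂ) → BondIdx Dm → Matrix (Fin 2) (Fin 2) ℂ) 0) Z) (X - H D') = D' → D' = D X)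
    (hDd : ∀ X : PBond (F.P K) 0 → Matrix (Fin 2) (Fin 2) ℂ, (∀ b, w 1 b * ‖X b‖ < r₁) → DifferentiableAt ℂ D X)
    (hball : ∀ X : PBond (F.P K) 0 → Matrix (Fin 2) (Fin 2) ℂ, (∀ b, w 1 b * ‖X b‖ < r₁) → ∀ b, w 1 b * ‖(X - H (D X)) b‖ < R)
    (Uc : (PBond (F.P K) 0 → Matrix (Fin 2) (Fin 2) ℂ) → GaugeField (F.P K) 0 (Matrix.specialUnitaryGroup (Fin 2) ℂ))
    (hUc : ∀ Y : PBond (F.P K) 0 → Matrix (Fin 2) (Fin 2) ℂ, (∀ b, IsSelfAdjoint (Y b)) → (∀ b, Matrix.trace (Y b) = 0) →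
      ∀ b, ((Uc Y b : Matrix.specialUnitaryGroup (Fin 2) ℂ) : Matrix (Fin 2) (Fin 2) ℂ) = exp ((Complex.I * (η : ℂ)) • Y b))
    (hUcont : ∀ b, Continuous fun Y : PBond (F.P K) 0 → Matrix (Fin 2) (Fin 2) ℂ => ((Uc Y b : Matrix.specialUnitaryGroup (Fin 2) ℂ) : Matrix (Fin 2) (Fin 2) ℂ))
    {A : PBond (F.P K) 0 → Matrix (Fin 2) (Fin 2) ℂ} (hAsa : ∀ b, IsSelfAdjoint (A b)) (hAtr : ∀ b, Matrix.trace (A b) = 0) (hAS : ∀ b, w 1 b * ‖A b‖ < r₁)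
    (hnK : n ≤ K) (ε₀ : ℝ) (hε0 : 0 ≤ ε₀) (V : GaugeField (F.P n) 0 (Matrix.specialUnitaryGroup (Fin 2) ℂ)) {Umin : GaugeField (F.P K) 0 (Matrix.specialUnitaryGroup (Fin 2) ℂ)}
    (hUmin : Umin ∈ regFibrePr F n K hnK ε₀ V)
    (hcrit : IsMinOn (fun W : GaugeField (F.P K) 0 (Matrix.specialUnitaryGroup (Fin 2) ℂ) => wilsonAction4 W) (regFibrePr F n K hnK ε₀ V) Umin)
    (hHinv : ∀ Y : BondIdx Dm → Matrix (Fin 2) (Fin 2) ℂ, (fderiv ℂ (chartLogFlat ((((F.L : ℝ))⁻¹) ^ (K - n)) Dm : (PBond (F.P K) 0 → Matrix (Fin 2) (Fin 2) ℂ) → BondIdx Dm → Matrix (Fin 2) (Fin 2) ℂ) 0) (H Y) = Y)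
    (Near : PBond (F.P K) 0 → Prop) [DecidablePred Near] (Tch : Plaq (F.P K) 0 → Prop)
    (hTN : ∀ p : Plaq (F.P K) 0, Tch p → Near ⟨p.src, p.μ⟩ ∧ Near ⟨p.src.shift p.μ, p.ν⟩ ∧ Near ⟨p.src.shift p.ν, p.μ⟩ ∧ Near ⟨p.src, p.ν⟩)
    (hTF : ∀ p : Plaq (F.P K) 0, ¬ Tch p → Dm.LamBond 0 ⟨p.src, p.μ⟩ ∧ Dm.LamBond 0 ⟨p.src.shift p.μ, p.ν⟩ ∧ Dm.LamBond 0 ⟨p.src.shift p.ν, p.μ⟩ ∧ Dm.LamBond 0 ⟨p.src, p.ν⟩)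
    (uS : GaugeTransf (F.P K) 0 (Matrix.specialUnitaryGroup (Fin 2) ℂ))
    (hchartNear : ∀ b, Near b → ((GaugeField.gaugeAct uS Umin b : Matrix.specialUnitaryGroup (Fin 2) ℂ) : Matrix (Fin 2) (Fin 2) ℂ) = exp ((Complex.I * (η : ℂ)) • (A - H (D A)) b))
    (hΦ1 : ∀ X ∈ {X : PBond (F.P K) 0 → Matrix (Fin 2) (Fin 2) ℂ | (∀ b, IsSelfAdjoint (X b)) ∧ (∀ b, Matrix.trace (X b) = 0) ∧ (∀ c : BondIdx Dm, bondAvgIter (c.1.1 : ℕ) X c.1.2 = bondAvgIter (c.1.1 : ℕ) A c.1.2) ∧ X ∈ {Y : PBond (F.P K) 0 → Matrix (Fin 2) (Fin 2) ℂ | ∀ b, w 1 b * ‖Y b‖ < r₁}},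
      RegPr F n K ε₀ (fun b => if Near b then Uc (X - H (D X)) b else GaugeField.gaugeAct uS Umin b) →
      ∃ h : GaugeTransf (F.P K) 0 (Matrix.specialUnitaryGroup (Fin 2) ℂ),
        GaugeField.gaugeAct h (fun b => if Near b then Uc (X - H (D X)) b else GaugeField.gaugeAct uS Umin b) ∈ fibre F ℰp n K hnK V) :
    ∀ s : PBond (F.P K) 0 → ℝ, QE Dm (WithLp.toLp 2 s) = 0 → ∀ Et : Matrix (Fin 2) (Fin 2) ℂ, IsSelfAdjoint Et → Matrix.trace Et = 0 →
    (((η : ℂ) ^ 2 / 2) * ∑ p : Plaq (F.P K) 0, Matrix.trace ((A ⟨p.src, p.μ⟩ + A ⟨p.src.shift p.μ, p.ν⟩ - A ⟨p.src.shift p.ν, p.μ⟩ - A ⟨p.src, p.ν⟩) * (((s ⟨p.src, p.μ⟩ : ℝ) : ℂ) • Et + ((s ⟨p.src.shift p.μ, p.ν⟩ : ℝ) : ℂ) • Et - ((s ⟨p.src.shift p.ν, p.μ⟩ : ℝ) : ℂ) • Et - ((s ⟨p.src, p.ν⟩ : ℝ) : ℂ) • Et)) +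
      (η : ℂ) ^ 4 * ∑ b : PBond (F.P K) 0, Matrix.trace ((W₀ (A - H (D A)) b + E A b) * (((s b : ℝ) : ℂ) • Et))).re = 0 := by
  have hw1 : ∀ b, 0 ≤ w 1 b := fun b => levWeight_nonneg hw 1 b
  set k : PBond (F.P K) 0 → BondIdx Dm → ℝ := fun b c => flatH F n K Dm (Pi.single c 1) b * ((F.L : ℝ) ^ (c.1.1 : ℕ) * ((F.L : ℝ)⁻¹) ^ (K - n))⁻¹ with hk
  have hHs' : ∀ X b, H X b = ∑ c, k b c • X c := hHs
  -- the dressed competitors are 𝔰𝔲(2)-valued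
  have hdress : ∀ X : PBond (F.P K) 0 → Matrix (Fin 2) (Fin 2) ℂ, (∀ b, IsSelfAdjoint (X b)) → (∀ b, Matrix.trace (X b) = 0) → (∀ b, w 1 b * ‖X b‖ < r₁) →
      (∀ b, IsSelfAdjoint ((X - H (D X)) b)) ∧ ∀ b, Matrix.trace ((X - H (D X)) b) = 0 := fun X hXsa hXtr hXS =>
    dressed_competitor_su2 F n K Dm hDk hcollar hw hR H k hHs' hXsa hXtr (hball X hXS) (h49 X hXS) (hsize X hXS) (huniq X hXS)
  have hdA := hdress A hAsa hAtr hAS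
  set T : Set (PBond (F.P K) 0 → Matrix (Fin 2) (Fin 2) ℂ) := {X : PBond (F.P K) 0 → Matrix (Fin 2) (Fin 2) ℂ | (∀ b, IsSelfAdjoint (X b)) ∧ (∀ b, Matrix.trace (X b) = 0) ∧
      (∀ c : BondIdx Dm, bondAvgIter (c.1.1 : ℕ) X c.1.2 = bondAvgIter (c.1.1 : ℕ) A c.1.2) ∧ X ∈ {Y : PBond (F.P K) 0 → Matrix (Fin 2) (Fin 2) ℂ | ∀ b, w 1 b * ‖Y b‖ < r₁}} with hT
  -- (a) the weight floor `η♭ ≤ w₁(b)` and the window `R ≤ 1/5`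
  have hL1 : (1 : ℝ) ≤ (F.L : ℝ) := by exact_mod_cast F.hL.2.le
  have hη0 : 0 ≤ ((F.L : ℝ))⁻¹ ^ (K - n) := pow_nonneg (inv_nonneg.2 (by positivity)) _
  have hwfloor : ∀ b : PBond (F.P K) 0, ((F.L : ℝ))⁻¹ ^ (K - n) ≤ w 1 b := fun b => by
    rw [hw 1 b, pow_one]
    exact le_mul_of_one_le_left hη0 (one_le_pow₀ hL1)
  have hR5 : R ≤ 1 / 5 := by
    by_cases hR0 : R ≤ 0
    · linarith
    have hR0' : 0 < R := lt_of_not_ge hR0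
    have hc : (1 : ℝ) ≤ ((((F.P K).d + 2) * (F.P K).L : ℕ) : ℝ) := by
      exact_mod_cast Nat.succ_le_of_lt (Nat.mul_pos (by omega) (F.P K).L_pos)
    have hc2 : (1 : ℝ) ≤ ((((F.P K).d + 2) * (F.P K).L : ℕ) : ℝ) ^ 2 * (F.L : ℝ) := one_le_mul_of_one_le_of_one_le (one_le_pow₀ hc) hL1
    have h1 : 16 * 3800 * R ≤ 16 * 3800 * ((((F.P K).d + 2) * (F.P K).L : ℕ) : ℝ) ^ 2 * (F.L : ℝ) * R := by nlinarith
    linarith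
  -- (b) PINNING: a level-0 index datum is the bond value, so every competitor equals `A` on `Λ₀`
  have hpin : ∀ X ∈ T, ∀ (b : PBond (F.P K) 0) (hb : Dm.LamBond 0 b), X b = A b := fun X hX b hb => by
    have h := hX.2.2.1 ⟨⟨⟨0, Nat.succ_pos _⟩, b⟩, hb⟩
    simpa only [bondAvgIter_zero] using h
  -- (c) THE LEVEL-0 DRESSING VANISHES on the ball ((49) at a level-0 index; `logTower_zero`)
  have hD0 : ∀ Y : PBond (F.P K) 0 → Matrix (Fin 2) (Fin 2) ℂ, (∀ b, w 1 b * ‖Y b‖ < r₁) → ∀ (b : PBond (F.P K) 0) (hb : Dm.LamBond 0 b),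
      D Y ⟨⟨⟨0, Nat.succ_pos _⟩, b⟩, hb⟩ = 0 := fun Y hY b hb => by
    have hsmall : ‖((((((F.L : ℝ))⁻¹ ^ (K - n) : ℝ)) : ℂ) • (Y - H (D Y))) b‖ ≤ 1 / 5 := by
      rw [Pi.smul_apply, norm_smul, Complex.norm_real, Real.norm_of_nonneg hη0]
      have h1 : ((F.L : ℝ))⁻¹ ^ (K - n) * ‖(Y - H (D Y)) b‖ ≤ w 1 b * ‖(Y - H (D Y)) b‖ := mul_le_mul_of_nonneg_right (hwfloor b) (norm_nonneg _)
      linarith [hball Y hY b]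
    have h := congr_fun (h49 Y hY) ⟨⟨⟨0, Nat.succ_pos _⟩, b⟩, hb⟩
    simp only [Pi.sub_apply] at h
    rw [fderiv_chartLogFlat_zero_apply, chartLogFlat_apply] at h
    have h' : (-Complex.I) • MatrixLog.mlog (((Prop8ChartDoubleBar.dbarIterU 0 (Prop8Chart.expCfg (((F.L : ℝ))⁻¹ ^ (K - n)) (Y - H (D Y)))) b :
        (Matrix (Fin 2) (Fin 2) ℂ)ˣ) : Matrix (Fin 2) (Fin 2) ℂ) -
        ((((((F.L : ℝ))⁻¹ ^ (K - n) : ℝ)) : ℂ) * (((F.P K).L : ℕ) : ℂ) ^ (0 : ℕ)) • bondAvgIter 0 (Y - H (D Y)) b = D Y ⟨⟨⟨0, Nat.succ_pos _⟩, b⟩, hb⟩ := h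
    rw [ChartKernelFlat.logTower_zero _ _ b hsmall, pow_zero, mul_one, bondAvgIter_zero, Pi.smul_apply, sub_self] at h'
    exact h'.symm
  -- `H` at a level-0 bond reads the level-0 datum (`hHinv` at level 0), so the dressing disappears from the dressed competitor on `Λ₀`
  have hHD0 : ∀ Y : PBond (F.P K) 0 → Matrix (Fin 2) (Fin 2) ℂ, (∀ b, w 1 b * ‖Y b‖ < r₁) → ∀ (b : PBond (F.P K) 0), Dm.LamBond 0 b → H (D Y) b = 0 :=
      fun Y hY b hb => by
    have h := congr_fun (hHinv (D Y)) ⟨⟨⟨0, Nat.succ_pos _⟩, b⟩, hb⟩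
    rw [fderiv_chartLogFlat_zero_apply] at h
    have h' : ((((((F.L : ℝ))⁻¹ ^ (K - n) : ℝ)) : ℂ) * (((F.P K).L : ℕ) : ℂ) ^ (0 : ℕ)) • bondAvgIter 0 (H (D Y)) b = D Y ⟨⟨⟨0, Nat.succ_pos _⟩, b⟩, hb⟩ := h
    rw [pow_zero, mul_one, bondAvgIter_zero, hD0 Y hY b hb, smul_eq_zero] at h'
    have hLpos : (0 : ℝ) < (F.L : ℝ) := by linarith
    have hηne : ((((F.L : ℝ))⁻¹ ^ (K - n) : ℝ) : ℂ) ≠ 0 := by exact_mod_cast (pow_pos (inv_pos.2 hLpos) (K - n)).ne'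
    exact h'.resolve_left hηne
  have hZ : ∀ X ∈ T, ∀ (b : PBond (F.P K) 0), Dm.LamBond 0 b → (X - H (D X)) b = (A - H (D A)) b := fun X hX b hb => by
    rw [Pi.sub_apply, Pi.sub_apply, hHD0 X hX.2.2.2 b hb, hHD0 A hAS b hb, hpin X hX b hb]
  -- (d) the local competitor map
  obtain ⟨Φloc, hΦloc⟩ : ∃ Φ : (PBond (F.P K) 0 → Matrix (Fin 2) (Fin 2) ℂ) → GaugeField (F.P K) 0 (Matrix.specialUnitaryGroup (Fin 2) ℂ),
      ∀ X b, Φ X b = if Near b then Uc (X - H (D X)) b else GaugeField.gaugeAct uS Umin b := ⟨fun X b => if Near b then Uc (X - H (D X)) b else GaugeField.gaugeAct uS Umin b, fun _ _ => rfl⟩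
  have hΦfun : ∀ X, Φloc X = fun b => if Near b then Uc (X - H (D X)) b else GaugeField.gaugeAct uS Umin b := fun X => funext (hΦloc X)
  -- the chart point hits the minimiser's gauge copy (REGIONAL chart identity on the Near bonds, the copy itself elsewhere)
  have hΦA : Φloc A = GaugeField.gaugeAct uS Umin := by
    funext b
    rw [hΦloc]
    by_cases hNb : Near b
    · rw [if_pos hNb]
      exact Subtype.ext (by rw [hUc _ hdA.1 hdA.2 b, hchartNear b hNb])
    · rw [if_neg hNb]
  -- the regular competitors: `Φloc A = uS • Umin` is regular; the cut-down set `S₂ = ball ∩ {RegPr (Φloc ·)}` and its competitor set `T₂ ⊆ T`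
  have hregA : RegPr F n K ε₀ (Φloc A) := by
    rw [hΦA]; exact regPr_gaugeAct_of_mem_regFibrePr F n K ε₀ hε0 hUmin uS
  set S₂ : Set (PBond (F.P K) 0 → Matrix (Fin 2) (Fin 2) ℂ) :=
    {Y : PBond (F.P K) 0 → Matrix (Fin 2) (Fin 2) ℂ | ∀ b, w 1 b * ‖Y b‖ < r₁} ∩ {Y | RegPr F n K ε₀ (Φloc Y)} with hS₂
  set T₂ : Set (PBond (F.P K) 0 → Matrix (Fin 2) (Fin 2) ℂ) := {X : PBond (F.P K) 0 → Matrix (Fin 2) (Fin 2) ℂ | (∀ b, IsSelfAdjoint (X b)) ∧ (∀ b, Matrix.trace (X b) = 0) ∧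
      (∀ c : BondIdx Dm, bondAvgIter (c.1.1 : ℕ) X c.1.2 = bondAvgIter (c.1.1 : ℕ) A c.1.2) ∧ X ∈ S₂} with hT₂
  have hT₂T : ∀ X ∈ T₂, X ∈ T := fun X hX => ⟨hX.1, hX.2.1, hX.2.2.1, hX.2.2.2.1⟩
  -- minimality on `T₂`: a regular competitor has an `SU(2)` gauge copy in the fibre, hence in print's regular fibre
  have hΦ1' : ∀ X ∈ T, RegPr F n K ε₀ (Φloc X) → ∃ h : GaugeTransf (F.P K) 0 (Matrix.specialUnitaryGroup (Fin 2) ℂ),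
      GaugeField.gaugeAct h (Φloc X) ∈ fibre F ℰp n K hnK V := fun X hX => by
    rw [hΦfun X]; exact hΦ1 X hX
  have hminΦ : IsMinOn (fun X => wilsonAction4 (Φloc X)) T₂ A := by
    intro X hX
    obtain ⟨h, hh⟩ := hΦ1' X (hT₂T X hX) hX.2.2.2.2
    have hmem : GaugeField.gaugeAct h (Φloc X) ∈ regFibrePr F n K hnK ε₀ V :=
      (mem_regFibrePr_iff F).2 ⟨hh, (regPr_gaugeAct_iff F hε0 h (Φloc X)).2 hX.2.2.2.2⟩
    have h1 : wilsonAction4 Umin ≤ wilsonAction4 (GaugeField.gaugeAct h (Φloc X)) := hcrit hmem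
    show wilsonAction 1 (Φloc A) ≤ wilsonAction 1 (Φloc X)
    rw [hΦA, T4WilsonGaugeFlatDirection.wilsonAction_gaugeAct]
    rwa [show wilsonAction4 (GaugeField.gaugeAct h (Φloc X)) = wilsonAction4 (Φloc X) from
      T4WilsonGaugeFlatDirection.wilsonAction_gaugeAct 1 h (Φloc X)] at h1
  -- the competitor lines are continuous at `0` (`Uc` continuous, `D` continuous at `A`, `H` linear on a finite-dimensional space), so `S₂` is open along lines at `A`
  have hcontΦ : ∀ δ : PBond (F.P K) 0 → Matrix (Fin 2) (Fin 2) ℂ, ContinuousAt (fun t : ℝ => Φloc (A + t • δ)) 0 := by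
    intro δ
    have hline : Continuous fun t : ℝ => A + t • δ := continuous_const.add (continuous_id.smul continuous_const)
    have hDA : ContinuousAt (fun t : ℝ => D (A + t • δ)) 0 := by
      have hD0 : ContinuousAt D (A + (0 : ℝ) • δ) := by rw [zero_smul, add_zero]; exact (hDd A hAS).continuousAt
      exact ContinuousAt.comp hD0 hline.continuousAt
    have hH : Continuous fun Y : BondIdx Dm → Matrix (Fin 2) (Fin 2) ℂ => H Y := H.continuous_of_finiteDimensional
    have hY : ContinuousAt (fun t : ℝ => (A + t • δ) - H (D (A + t • δ))) 0 := hline.continuousAt.sub (hH.continuousAt.comp hDA)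
    refine continuousAt_pi.2 fun b => ?_
    by_cases hNb : Near b
    · have hΦb : (fun t : ℝ => Φloc (A + t • δ) b) = fun t : ℝ => Uc ((A + t • δ) - H (D (A + t • δ))) b := by
        funext t; rw [hΦloc, if_pos hNb]
      rw [hΦb, Topology.IsInducing.subtypeVal.continuousAt_iff]
      exact ((hUcont b).continuousAt).comp hY
    · have hΦb : (fun t : ℝ => Φloc (A + t • δ) b) = fun _ : ℝ => GaugeField.gaugeAct uS Umin b := by
        funext t; rw [hΦloc, if_neg hNb]
      rw [hΦb]
      exact continuousAt_const
  have hS₂open : ∀ δ : PBond (F.P K) 0 → Matrix (Fin 2) (Fin 2) ℂ, ∃ r : ℝ, 0 < r ∧ ∀ t : ℝ, |t| < r → A + t • δ ∈ S₂ := by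
    rw [hS₂]
    refine lineOpen_inter_regPr F n K ε₀ Φloc _ A (fun δ => ?_) hregA hcontΦ
    obtain ⟨r, hr, h⟩ := exists_lineRadius_of_mem_weightedBall (w 1) hw1 hAS δ
    exact ⟨r, hr, fun t ht => h t ht⟩
  have hAS₂ : A ∈ S₂ := ⟨hAS, hregA⟩
  -- the chart on the sides of the `Tch`-plaquettes
  have hexp : ∀ X ∈ T₂, ∀ p : Plaq (F.P K) 0, Tch p →
      ((Φloc X ⟨p.src, p.μ⟩ : Matrix.specialUnitaryGroup (Fin 2) ℂ) : Matrix (Fin 2) (Fin 2) ℂ) = exp ((Complex.I * (η : ℂ)) • (X - H (D X)) ⟨p.src, p.μ⟩) ∧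
      ((Φloc X ⟨p.src.shift p.μ, p.ν⟩ : Matrix.specialUnitaryGroup (Fin 2) ℂ) : Matrix (Fin 2) (Fin 2) ℂ) = exp ((Complex.I * (η : ℂ)) • (X - H (D X)) ⟨p.src.shift p.μ, p.ν⟩) ∧
      ((Φloc X ⟨p.src.shift p.ν, p.μ⟩ : Matrix.specialUnitaryGroup (Fin 2) ℂ) : Matrix (Fin 2) (Fin 2) ℂ) = exp ((Complex.I * (η : ℂ)) • (X - H (D X)) ⟨p.src.shift p.ν, p.μ⟩) ∧
      ((Φloc X ⟨p.src, p.ν⟩ : Matrix.specialUnitaryGroup (Fin 2) ℂ) : Matrix (Fin 2) (Fin 2) ℂ) = exp ((Complex.I * (η : ℂ)) • (X - H (D X)) ⟨p.src, p.ν⟩) := by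
    intro X hX₂ p hp
    have hX := hT₂T X hX₂
    obtain ⟨h1, h2, h3, h4⟩ := hTN p hp
    have hd := hdress X hX.1 hX.2.1 hX.2.2.2
    have hc : ∀ b, Near b → ((Φloc X b : Matrix.specialUnitaryGroup (Fin 2) ℂ) : Matrix (Fin 2) (Fin 2) ℂ) = exp ((Complex.I * (η : ℂ)) • (X - H (D X)) b) :=
      fun b hb => by rw [hΦloc, if_pos hb]; exact hUc _ hd.1 hd.2 b
    exact ⟨hc _ h1, hc _ h2, hc _ h3, hc _ h4⟩
  -- off the `Tch`-plaquettes the competitor and its dressed field are those of `A` (pinning + level-0 dressing)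
  have hoff : ∀ X ∈ T₂, ∀ p : Plaq (F.P K) 0, ¬ Tch p →
      (Φloc X ⟨p.src, p.μ⟩ = Φloc A ⟨p.src, p.μ⟩ ∧ Φloc X ⟨p.src.shift p.μ, p.ν⟩ = Φloc A ⟨p.src.shift p.μ, p.ν⟩ ∧
        Φloc X ⟨p.src.shift p.ν, p.μ⟩ = Φloc A ⟨p.src.shift p.ν, p.μ⟩ ∧ Φloc X ⟨p.src, p.ν⟩ = Φloc A ⟨p.src, p.ν⟩) ∧
      ((X - H (D X)) ⟨p.src, p.μ⟩ = (A - H (D A)) ⟨p.src, p.μ⟩ ∧ (X - H (D X)) ⟨p.src.shift p.μ, p.ν⟩ = (A - H (D A)) ⟨p.src.shift p.μ, p.ν⟩ ∧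
        (X - H (D X)) ⟨p.src.shift p.ν, p.μ⟩ = (A - H (D A)) ⟨p.src.shift p.ν, p.μ⟩ ∧ (X - H (D X)) ⟨p.src, p.ν⟩ = (A - H (D A)) ⟨p.src, p.ν⟩) := by
    intro X hX₂ p hp
    have hX := hT₂T X hX₂
    obtain ⟨h1, h2, h3, h4⟩ := hTF p hp
    have hdX := hdress X hX.1 hX.2.1 hX.2.2.2
    have hΦb : ∀ b : PBond (F.P K) 0, Dm.LamBond 0 b → Φloc X b = Φloc A b := fun b hb => by
      rw [hΦloc, hΦloc]
      by_cases hNb : Near b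
      · rw [if_pos hNb, if_pos hNb]
        exact Subtype.ext (by rw [hUc _ hdX.1 hdX.2 b, hUc _ hdA.1 hdA.2 b, hZ X hX b hb])
      · rw [if_neg hNb, if_neg hNb]
    exact ⟨⟨hΦb _ h1, hΦb _ h2, hΦb _ h3, hΦb _ h4⟩, ⟨hZ X hX _ h1, hZ X hX _ h2, hZ X hX _ h3, hZ X hX _ h4⟩⟩
  -- FILE A §4, on the cut-down competitor set
  exact HalvingCompetitorMapAction.tracePairing_of_isMinOn_localChart Dm η hη W₀ hSd hgrad H D E hE
    (S₀ := S₂) (Bdat := fun c => bondAvgIter (c.1.1 : ℕ) A c.1.2) Tch Φloc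
    (fun X hX => (hdress X hX.1 hX.2.1 hX.2.2.2.1).1) hexp hoff hAsa hAtr (fun c => rfl) hAS₂ hS₂open (hDd A hAS) hminΦ

end Summit.QuantumFields.YangMills.Theorems.HalvingSitePackage

end
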